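import Literature.Computability.AlgebraicComplexity.QuantumFunctionalsDirectSumMarginals
import Literature.Computability.AlgebraicComplexity.QuantumFunctionalSpectral
import HarnessLib

/-!
# Entropies of the quantum marginals of `c • t` and `s ⊕ t`

Topic `Literature/Computability/AlgebraicComplexity`; support file for the proof of
Christandl–Vrana–Zuiddam, *Universal points in the asymptotic spectrum of tensors* (JAMS 36 (2023)),
Thm. 3.19.2 = Lem. 3.22 (super-additivity of the lower quantum functional), towards Cor. 3.31
(`ChristandlVranaZuiddam2023_mem_asymptoticSpectrum`). From the marginal computations of
`QuantumFunctionalsDirectSumMarginals.lean` and the spectral sums of `QuantumFunctionalSpectral.lean`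
it derives, for the marginal entropies `H(rⱼ(·)) = shannonEntropy (marginalSpectrumⱼ ·)` and their
`θ`-weighted average `H_θ = quantumEntropy θ`:

* scale invariance `H_θ(c t) = H_θ(t)` for `c ≠ 0` (Rem. 3.17: the supremum defining `E_θ` may be
  taken over inner products for which `t` is a unit vector);
* the recursion (grouping) rule `H_θ(s ⊕ t) = h(P) + P·H_θ(s) + (1-P)·H_θ(t)` with
  `P = ⟨s|s⟩/(⟨s|s⟩+⟨t|t⟩)`, for `θ ∈ P([3])` (Lem. 3.21 "recursion property of quantum entropy" and
  the proof of Lem. 3.22), valid also when `s` or `t` vanishes.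

Generic forms for Hermitian matrices (`sum_negMulLog_div_*`) are proved first. The Kronecker
analogue `H_θ(s ⊗ t) = H_θ(s) + H_θ(t)` is `quantumEntropy_kroneckerTensor`
(`QuantumFunctionalsKronecker.lean`). No definitions are introduced.

Reference: M. Christandl, P. Vrana, J. Zuiddam, JAMS 36 (2023) 31–79 = arXiv:1709.07851v3, §3.2
(Rem. 3.17, Lem. 3.21–3.22).
-/

noncomputable section

open scoped BigOperators Matrix Kronecker ComplexOrder
open Real (negMulLog)

namespace Literature.Computability.AlgebraicComplexity

/-! ## Spectral entropies: the generic identities -/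

section SpectralEntropy

variable {n m : Type*} [Fintype n] [Fintype m] [DecidableEq n] [DecidableEq m]

/-- Transport of spectral sums along an equality of matrices. [folklore] -/
theorem sum_eigenvalues_congr {A B : Matrix n n ℂ} (h : A = B) (hA : A.IsHermitian) (hB : B.IsHermitian)
    (f : ℝ → ℝ) : ∑ i, f (hA.eigenvalues i) = ∑ i, f (hB.eigenvalues i) := by
  subst h
  rfl

omit [DecidableEq n] in
/-- **Grouping rule for `-x log x`** (one block): if `∑ λᵢ = a` and `a = 0` forces `λ = 0`, then
`∑ᵢ η(λᵢ/c) = η(a/c) + (a/c) ∑ᵢ η(λᵢ/a)` with `η = negMulLog` (CVZ Lem. 3.21, recursion property of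
entropy, scalar form). [cite: ChristandlVranaZuiddam2023, Lem. 3.21] -/
theorem sum_negMulLog_div_eq_grouping {l : n → ℝ} {a : ℝ} (hsum : ∑ i, l i = a)
    (hzero : a = 0 → ∀ i, l i = 0) (c : ℝ) :
    ∑ i, negMulLog (l i / c) = negMulLog (a / c) + a / c * ∑ i, negMulLog (l i / a) := by
  by_cases ha : a = 0
  · have hl := hzero ha
    simp [hl, ha]
  · have hsum' : ∑ i, l i / a = 1 := by rw [← Finset.sum_div, hsum, div_self ha]
    calc ∑ i, negMulLog (l i / c) = ∑ i, negMulLog (l i / a * (a / c)) := by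
          refine Finset.sum_congr rfl fun i _ => ?_
          rw [div_mul_div_comm, mul_comm (l i) a, mul_div_mul_left _ _ ha]
      _ = ∑ i, (a / c * negMulLog (l i / a) + l i / a * negMulLog (a / c)) := by
          refine Finset.sum_congr rfl fun i _ => ?_
          rw [Real.negMulLog_mul]
      _ = negMulLog (a / c) + a / c * ∑ i, negMulLog (l i / a) := by
          rw [Finset.sum_add_distrib, ← Finset.mul_sum, ← Finset.sum_mul, hsum', one_mul, add_comm]

end SpectralEntropy

/-! ## Entropies of the marginals of `c • t` and `s ⊕ t` -/

section MarginalEntropy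

variable {ι κ μ ι' κ' μ' : Type*} [Fintype ι] [Fintype κ] [Fintype μ] [Fintype ι'] [Fintype κ']
  [Fintype μ'] [DecidableEq ι] [DecidableEq κ] [DecidableEq μ] [DecidableEq ι'] [DecidableEq κ']
  [DecidableEq μ']

omit [Fintype ι'] [Fintype κ'] [Fintype μ'] [DecidableEq κ] [DecidableEq μ] [DecidableEq ι'] [DecidableEq κ']
  [DecidableEq μ'] in
/-- Unfolding: `H(r₁(t)) = (∑ᵢ η(λᵢ(|t⟩⟨t|₁)/⟨t|t⟩)) / log 2`. [folklore] -/
theorem shannonEntropy_marginalSpectrum₁ (t : ι → κ → μ → ℂ) :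
    shannonEntropy (marginalSpectrum₁ t) =
      (∑ i, negMulLog ((isHermitian_reducedDensity₁ t).eigenvalues i / tensorNormSq t)) / Real.log 2 :=
  rfl

omit [Fintype ι'] [Fintype κ'] [Fintype μ'] [DecidableEq ι] [DecidableEq μ] [DecidableEq ι'] [DecidableEq κ']
  [DecidableEq μ'] in
/-- Unfolding: `H(r₂(t)) = (∑ᵢ η(λᵢ(|t⟩⟨t|₂)/⟨t|t⟩)) / log 2`. [folklore] -/
theorem shannonEntropy_marginalSpectrum₂ (t : ι → κ → μ → ℂ) :
    shannonEntropy (marginalSpectrum₂ t) =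
      (∑ i, negMulLog ((isHermitian_reducedDensity₂ t).eigenvalues i / tensorNormSq t)) / Real.log 2 :=
  rfl

omit [Fintype ι'] [Fintype κ'] [Fintype μ'] [DecidableEq ι] [DecidableEq κ] [DecidableEq ι'] [DecidableEq κ']
  [DecidableEq μ'] in
/-- Unfolding: `H(r₃(t)) = (∑ᵢ η(λᵢ(|t⟩⟨t|₃)/⟨t|t⟩)) / log 2`. [folklore] -/
theorem shannonEntropy_marginalSpectrum₃ (t : ι → κ → μ → ℂ) :
    shannonEntropy (marginalSpectrum₃ t) =
      (∑ i, negMulLog ((isHermitian_reducedDensity₃ t).eigenvalues i / tensorNormSq t)) / Real.log 2 :=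
  rfl

/-- Generic scale invariance: if `B = ‖c‖² A` (`c ≠ 0`) then the normalised spectral entropies of
`B` w.r.t. `‖c‖² N` and of `A` w.r.t. `N` agree. [folklore] -/
theorem sum_negMulLog_div_of_eq_smul {n : Type*} [Fintype n] [DecidableEq n] {A B : Matrix n n ℂ}
    {c : ℂ} (hc : c ≠ 0) (h : B = ((‖c‖ ^ 2 : ℝ) : ℂ) • A) (hA : A.IsHermitian) (hB : B.IsHermitian)
    (N : ℝ) :
    ∑ i, negMulLog (hB.eigenvalues i / (‖c‖ ^ 2 * N)) = ∑ i, negMulLog (hA.eigenvalues i / N) := by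
  have hc2 : (‖c‖ ^ 2 : ℝ) ≠ 0 := pow_ne_zero _ (norm_ne_zero_iff.2 hc)
  have h' : B = (RCLike.ofReal (‖c‖ ^ 2) : ℂ) • A := h
  have e1 := sum_eigenvalues_congr h' hB (isHermitian_real_smul hA _)
    (fun x => negMulLog (x / (‖c‖ ^ 2 * N)))
  have e2 := sum_eigenvalues_real_smul hA (‖c‖ ^ 2) (isHermitian_real_smul hA _)
    (fun x => negMulLog (x / (‖c‖ ^ 2 * N)))
  beta_reduce at e1 e2
  rw [e1, e2]
  refine Finset.sum_congr rfl fun i _ => ?_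
  rw [mul_div_mul_left _ _ hc2]

/-- **Scale invariance of the marginal entropies**: `H(rⱼ(c t)) = H(rⱼ(t))` for `c ≠ 0`
(CVZ Rem. 3.17: one may normalise `t`). [cite: ChristandlVranaZuiddam2023, Rem. 3.17] -/
theorem shannonEntropy_marginalSpectrum_smul {c : ℂ} (hc : c ≠ 0) (t : ι → κ → μ → ℂ) :
    shannonEntropy (marginalSpectrum₁ (c • t)) = shannonEntropy (marginalSpectrum₁ t) ∧
      shannonEntropy (marginalSpectrum₂ (c • t)) = shannonEntropy (marginalSpectrum₂ t) ∧
      shannonEntropy (marginalSpectrum₃ (c • t)) = shannonEntropy (marginalSpectrum₃ t) := by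
  refine ⟨?_, ?_, ?_⟩
  · rw [shannonEntropy_marginalSpectrum₁, shannonEntropy_marginalSpectrum₁, tensorNormSq_smul,
      sum_negMulLog_div_of_eq_smul hc (reducedDensity₁_smul c t) (isHermitian_reducedDensity₁ t)]
  · rw [shannonEntropy_marginalSpectrum₂, shannonEntropy_marginalSpectrum₂, tensorNormSq_smul,
      sum_negMulLog_div_of_eq_smul hc (reducedDensity₂_smul c t) (isHermitian_reducedDensity₂ t)]
  · rw [shannonEntropy_marginalSpectrum₃, shannonEntropy_marginalSpectrum₃, tensorNormSq_smul,
      sum_negMulLog_div_of_eq_smul hc (reducedDensity₃_smul c t) (isHermitian_reducedDensity₃ t)]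

/-- `H_θ(c t) = H_θ(t)` for `c ≠ 0`. [cite: ChristandlVranaZuiddam2023, Rem. 3.17] -/
theorem quantumEntropy_smul (θ : Fin 3 → ℝ) {c : ℂ} (hc : c ≠ 0) (t : ι → κ → μ → ℂ) :
    quantumEntropy θ (c • t) = quantumEntropy θ t := by
  obtain ⟨h1, h2, h3⟩ := shannonEntropy_marginalSpectrum_smul hc t
  simp only [quantumEntropy, h1, h2, h3]

omit [Fintype ι'] [Fintype κ'] [Fintype μ'] [DecidableEq κ] [DecidableEq μ] [DecidableEq ι'] [DecidableEq κ']
  [DecidableEq μ'] in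
/-- The eigenvalues of an unnormalised marginal sum to the squared norm (trace), `j = 1`. [folklore] -/
theorem sum_eigenvalues_reducedDensity₁ (t : ι → κ → μ → ℂ) :
    ∑ i, (isHermitian_reducedDensity₁ t).eigenvalues i = tensorNormSq t := by
  rw [sum_eigenvalues_eq_re_trace, trace_reducedDensity₁, RCLike.re_to_complex, Complex.ofReal_re]

omit [Fintype ι'] [Fintype κ'] [Fintype μ'] [DecidableEq ι] [DecidableEq μ] [DecidableEq ι'] [DecidableEq κ']
  [DecidableEq μ'] in
/-- The eigenvalues of an unnormalised marginal sum to the squared norm (trace), `j = 2`. [folklore] -/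
theorem sum_eigenvalues_reducedDensity₂ (t : ι → κ → μ → ℂ) :
    ∑ i, (isHermitian_reducedDensity₂ t).eigenvalues i = tensorNormSq t := by
  rw [sum_eigenvalues_eq_re_trace, trace_reducedDensity₂, RCLike.re_to_complex, Complex.ofReal_re]

omit [Fintype ι'] [Fintype κ'] [Fintype μ'] [DecidableEq ι] [DecidableEq κ] [DecidableEq ι'] [DecidableEq κ']
  [DecidableEq μ'] in
/-- The eigenvalues of an unnormalised marginal sum to the squared norm (trace), `j = 3`. [folklore] -/
theorem sum_eigenvalues_reducedDensity₃ (t : ι → κ → μ → ℂ) :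
    ∑ i, (isHermitian_reducedDensity₃ t).eigenvalues i = tensorNormSq t := by
  rw [sum_eigenvalues_eq_re_trace, trace_reducedDensity₃, RCLike.re_to_complex, Complex.ofReal_re]

/-- The eigenvalues of the marginals of the zero tensor vanish. [folklore] -/
theorem eigenvalues_reducedDensity_eq_zero_of_eq_zero {t : ι → κ → μ → ℂ} (ht : tensorNormSq t = 0) :
    (∀ i, (isHermitian_reducedDensity₁ t).eigenvalues i = 0) ∧
      (∀ i, (isHermitian_reducedDensity₂ t).eigenvalues i = 0) ∧
      (∀ i, (isHermitian_reducedDensity₃ t).eigenvalues i = 0) := by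
  have h0 : t = 0 := (tensorNormSq_eq_zero_iff t).1 ht
  subst h0
  have h1 : reducedDensity₁ (0 : ι → κ → μ → ℂ) = 0 := by ext; simp [reducedDensity₁_apply]
  have h2 : reducedDensity₂ (0 : ι → κ → μ → ℂ) = 0 := by ext; simp [reducedDensity₂_apply]
  have h3 : reducedDensity₃ (0 : ι → κ → μ → ℂ) = 0 := by ext; simp [reducedDensity₃_apply]
  refine ⟨fun i => ?_, fun i => ?_, fun i => ?_⟩
  · exact congrFun ((Matrix.IsHermitian.eigenvalues_eq_zero_iff _).2 h1) i
  · exact congrFun ((Matrix.IsHermitian.eigenvalues_eq_zero_iff _).2 h2) i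
  · exact congrFun ((Matrix.IsHermitian.eigenvalues_eq_zero_iff _).2 h3) i

/-- Generic block rule for normalised spectral entropies: if `K = A ⊕ B` (block diagonal) with
`∑ λ(A) = a`, `∑ λ(B) = b`, `a = 0 ⇒ λ(A) = 0`, `b = 0 ⇒ λ(B) = 0`, then w.r.t. `c` the entropy of
`K` is `η(a/c) + η(b/c) + (a/c)·S_A + (b/c)·S_B`. [folklore] -/
theorem sum_negMulLog_div_of_eq_fromBlocks {n m : Type*} [Fintype n] [Fintype m] [DecidableEq n]
    [DecidableEq m] {A : Matrix n n ℂ} {B : Matrix m m ℂ} {K : Matrix (n ⊕ m) (n ⊕ m) ℂ}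
    (h : K = Matrix.fromBlocks A 0 0 B) (hA : A.IsHermitian) (hB : B.IsHermitian) (hK : K.IsHermitian)
    {a b : ℝ} (ha : ∑ i, hA.eigenvalues i = a) (hb : ∑ j, hB.eigenvalues j = b)
    (ha0 : a = 0 → ∀ i, hA.eigenvalues i = 0) (hb0 : b = 0 → ∀ j, hB.eigenvalues j = 0) (c : ℝ) :
    ∑ p, negMulLog (hK.eigenvalues p / c) =
      negMulLog (a / c) + negMulLog (b / c) + a / c * ∑ i, negMulLog (hA.eigenvalues i / a) +
        b / c * ∑ j, negMulLog (hB.eigenvalues j / b) := by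
  have e1 := sum_eigenvalues_congr h hK (isHermitian_fromBlocks_zero hA hB) (fun x => negMulLog (x / c))
  have e2 := sum_eigenvalues_fromBlocks hA hB (isHermitian_fromBlocks_zero hA hB)
    (fun x => negMulLog (x / c))
  beta_reduce at e1 e2
  rw [e1, e2, sum_negMulLog_div_eq_grouping ha ha0 c, sum_negMulLog_div_eq_grouping hb hb0 c]
  ring

/-- **Recursion (grouping) rule for the marginal entropies of a direct sum** (CVZ Lem. 3.21/3.22):
with `P = ⟨s|s⟩/(⟨s|s⟩ + ⟨t|t⟩)` and `h(P) = (η(P) + η(1-P))/log 2` the binary entropy,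
`H(rⱼ(s ⊕ t)) = h(P) + P·H(rⱼ(s)) + (1-P)·H(rⱼ(t))` for `j = 1,2,3`, whenever `s ⊕ t ≠ 0`; stated
with `1 - P` written as `⟨t|t⟩/(⟨s|s⟩ + ⟨t|t⟩)`. [cite: ChristandlVranaZuiddam2023, Lem. 3.22] -/
theorem shannonEntropy_marginalSpectrum_directSumTensor (s : ι → κ → μ → ℂ) (t : ι' → κ' → μ' → ℂ) :
    let N := tensorNormSq s + tensorNormSq t
    let P := tensorNormSq s / N
    let Q := tensorNormSq t / N
    shannonEntropy (marginalSpectrum₁ (directSumTensor s t)) =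
        (negMulLog P + negMulLog Q) / Real.log 2 + P * shannonEntropy (marginalSpectrum₁ s) +
          Q * shannonEntropy (marginalSpectrum₁ t) ∧
      shannonEntropy (marginalSpectrum₂ (directSumTensor s t)) =
        (negMulLog P + negMulLog Q) / Real.log 2 + P * shannonEntropy (marginalSpectrum₂ s) +
          Q * shannonEntropy (marginalSpectrum₂ t) ∧
      shannonEntropy (marginalSpectrum₃ (directSumTensor s t)) =
        (negMulLog P + negMulLog Q) / Real.log 2 + P * shannonEntropy (marginalSpectrum₃ s) +
          Q * shannonEntropy (marginalSpectrum₃ t) := by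
  intro N P Q
  have hs0 := fun h => (eigenvalues_reducedDensity_eq_zero_of_eq_zero (t := s) h).1
  have hs0' := fun h => (eigenvalues_reducedDensity_eq_zero_of_eq_zero (t := s) h).2.1
  have hs0'' := fun h => (eigenvalues_reducedDensity_eq_zero_of_eq_zero (t := s) h).2.2
  have ht0 := fun h => (eigenvalues_reducedDensity_eq_zero_of_eq_zero (t := t) h).1
  have ht0' := fun h => (eigenvalues_reducedDensity_eq_zero_of_eq_zero (t := t) h).2.1
  have ht0'' := fun h => (eigenvalues_reducedDensity_eq_zero_of_eq_zero (t := t) h).2.2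
  refine ⟨?_, ?_, ?_⟩
  · rw [shannonEntropy_marginalSpectrum₁, shannonEntropy_marginalSpectrum₁,
      shannonEntropy_marginalSpectrum₁, tensorNormSq_directSumTensor,
      sum_negMulLog_div_of_eq_fromBlocks (reducedDensity₁_directSumTensor s t)
        (isHermitian_reducedDensity₁ s) (isHermitian_reducedDensity₁ t) _
        (sum_eigenvalues_reducedDensity₁ s) (sum_eigenvalues_reducedDensity₁ t) hs0 ht0]
    simp only [P, Q, N]
    ring
  · rw [shannonEntropy_marginalSpectrum₂, shannonEntropy_marginalSpectrum₂,
      shannonEntropy_marginalSpectrum₂, tensorNormSq_directSumTensor,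
      sum_negMulLog_div_of_eq_fromBlocks (reducedDensity₂_directSumTensor s t)
        (isHermitian_reducedDensity₂ s) (isHermitian_reducedDensity₂ t) _
        (sum_eigenvalues_reducedDensity₂ s) (sum_eigenvalues_reducedDensity₂ t) hs0' ht0']
    simp only [P, Q, N]
    ring
  · rw [shannonEntropy_marginalSpectrum₃, shannonEntropy_marginalSpectrum₃,
      shannonEntropy_marginalSpectrum₃, tensorNormSq_directSumTensor,
      sum_negMulLog_div_of_eq_fromBlocks (reducedDensity₃_directSumTensor s t)
        (isHermitian_reducedDensity₃ s) (isHermitian_reducedDensity₃ t) _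
        (sum_eigenvalues_reducedDensity₃ s) (sum_eigenvalues_reducedDensity₃ t) hs0'' ht0'']
    simp only [P, Q, N]
    ring

/-- **`H_θ(s ⊕ t) = h(P) + P H_θ(s) + (1-P) H_θ(t)`** with `P = ⟨s|s⟩/(⟨s|s⟩+⟨t|t⟩)`, for
`θ ∈ P([3])` (CVZ, proof of Lem. 3.22: "Taking the θ-weighted average of both sides gives
`H_θ(u) = p H_θ(s) + (1-p) H_θ(t) + h(p)`"). [cite: ChristandlVranaZuiddam2023, Lem. 3.22] -/
theorem quantumEntropy_directSumTensor {θ : Fin 3 → ℝ} (hθ : θ ∈ stdSimplex ℝ (Fin 3))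
    (s : ι → κ → μ → ℂ) (t : ι' → κ' → μ' → ℂ) :
    let N := tensorNormSq s + tensorNormSq t
    quantumEntropy θ (directSumTensor s t) =
      (negMulLog (tensorNormSq s / N) + negMulLog (tensorNormSq t / N)) / Real.log 2 +
        tensorNormSq s / N * quantumEntropy θ s + tensorNormSq t / N * quantumEntropy θ t := by
  intro N
  obtain ⟨h1, h2, h3⟩ := shannonEntropy_marginalSpectrum_directSumTensor s t
  have hθ1 : θ 0 + θ 1 + θ 2 = 1 := by
    have := hθ.2
    simpa [Fin.sum_univ_three] using this
  simp only [quantumEntropy, h1, h2, h3]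
  linear_combination ((negMulLog (tensorNormSq s / N) + negMulLog (tensorNormSq t / N)) / Real.log 2) * hθ1

/-- **`H_θ(0 ⊕ t) = H_θ(t)`** (`θ ∈ P([3])`): the degenerate case `P = 0` of the recursion rule
(zero blocks do not change the normalised spectrum). [cite: ChristandlVranaZuiddam2023, Lem. 3.22] -/
theorem quantumEntropy_directSumTensor_zero_left {θ : Fin 3 → ℝ} (hθ : θ ∈ stdSimplex ℝ (Fin 3))
    (t : ι' → κ' → μ' → ℂ) :
    quantumEntropy θ (directSumTensor (0 : ι → κ → μ → ℂ) t) = quantumEntropy θ t := by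
  by_cases ht : t = 0
  · subst ht
    rw [directSumTensor_zero_zero, quantumEntropy_zero, quantumEntropy_zero]
  have hN : 0 < tensorNormSq t :=
    (tensorNormSq_nonneg t).lt_of_ne' (mt (tensorNormSq_eq_zero_iff t).1 ht)
  have h := quantumEntropy_directSumTensor hθ (0 : ι → κ → μ → ℂ) t
  simp only at h
  have h0 : tensorNormSq (0 : ι → κ → μ → ℂ) = 0 := (tensorNormSq_eq_zero_iff _).2 rfl
  rw [h, h0]
  simp [hN.ne']

/-- **`H_θ(s ⊕ 0) = H_θ(s)`** (`θ ∈ P([3])`): the degenerate case `P = 1` of the recursion rule.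
[cite: ChristandlVranaZuiddam2023, Lem. 3.22] -/
theorem quantumEntropy_directSumTensor_zero_right {θ : Fin 3 → ℝ} (hθ : θ ∈ stdSimplex ℝ (Fin 3))
    (s : ι → κ → μ → ℂ) :
    quantumEntropy θ (directSumTensor s (0 : ι' → κ' → μ' → ℂ)) = quantumEntropy θ s := by
  by_cases hs : s = 0
  · subst hs
    rw [directSumTensor_zero_zero, quantumEntropy_zero, quantumEntropy_zero]
  have hN : 0 < tensorNormSq s :=
    (tensorNormSq_nonneg s).lt_of_ne' (mt (tensorNormSq_eq_zero_iff s).1 hs)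
  have h := quantumEntropy_directSumTensor hθ s (0 : ι' → κ' → μ' → ℂ)
  simp only at h
  have h0 : tensorNormSq (0 : ι' → κ' → μ' → ℂ) = 0 := (tensorNormSq_eq_zero_iff _).2 rfl
  rw [h, h0]
  simp [hN.ne']

end MarginalEntropy

end Literature.Computability.AlgebraicComplexity

end
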